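import Literature.InformationTheory.Entropy.WeakMonotonicityFromRelEntropy
import Literature.InformationTheory.Entropy.VonNeumannEntropyOrthogonalSupports
import Literature.InformationTheory.Entropy.VonNeumannEntropyConcavity
import HarnessLib

/-!
# The mixing-entropy bound: `S(Σ_x p_x ρ_x) ≤ Σ_x p_x S(ρ_x) + H(p)`

Topic `Literature/InformationTheory/Entropy` (namespace = path). The companion upper bound of the concavity
`Σ_x p_x S(ρ_x) ≤ S(Σ_x p_x ρ_x)` (`VonNeumannEntropyConcavity.lean`): for density matrices `ρ_x` on a finite index type and a
probability vector `p`, `S(Σ_x p_x ρ_x) ≤ Σ_x p_x S(ρ_x) + H(p)`, `H(p) = Σ_x η(p_x)` the Shannon entropy of the weights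
[cite: NielsenChuang2010, Theorem 11.10 eq. (11.88) p.518] («S(Σ_i p_i ρ_i) ≤ Σ_i p_i S(ρ_i) + H(p_i)»). In particular the entropy
of a mixture exceeds the mixed entropy by at most `H(p) ≤ log |X|` — a VOLUME-INDEPENDENT amount, which is what the
thermodynamic-limit variational principle needs to split the entropy density of a mixture of translation-invariant states into
that of its components (`Literature/MathematicalPhysics/QuantumLattice/HubbardTTPrimeThermalStatesEntropyDensity*`).

PROOF (from WEAK MONOTONICITY, the tree's `weak_monotonicity_holds` — Lieb–Ruskai — with a classical copy): for the state
`τ = Σ_x p_x ρ_x ⊗ |x⟩⟨x| ⊗ |x⟩⟨x|` on `ℋ_m ⊗ ℋ_X ⊗ ℋ_X`, weak monotonicity `S(ρ_1) + S(ρ_3) ≤ S(ρ_{12}) + S(ρ_{23})` reads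
`S(Σ p_x ρ_x) + H(p) ≤ (Σ p_x S(ρ_x) + H(p)) + H(p)`: the marginals are `ρ_1 = Σ_x p_x ρ_x`, `ρ_3 = diag(p)`,
`ρ_{12} = ⊕_x p_x ρ_x` (orthogonal supports), `ρ_{23} = diag` on the diagonal of `X × X`.

* `vonNeumannEntropy_convexComb_le_add_negMulLog` — the bound above; `vonNeumannEntropy_convexComb_two_le` — the two-point form
  `S((1−t)ρ + tσ) ≤ (1−t)S(ρ) + tS(σ) + η(1−t) + η(t)` (`≤ … + log 2`, `…_le_add_log_two`).

Everything is PROVED; no definition (the auxiliary state `τ` is an explicit `Matrix.of`, handled through the hypothesis shape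
`hτ : ∀ i j, τ i j = …` of the private lemmas); no named fact.

## Tree / Mathlib search

REUSED: `weak_monotonicity_holds` (`WeakMonotonicityFromRelEntropy`), `traceLast(_apply)`, `traceLeft/traceRight(_apply)`, `IsDensity`
(`VonNeumannEntropyInequalities`, `QuantumMarginals`); `vonNeumannEntropy_sum_smul_of_orthogonalSupports`,
`vonNeumannEntropy_eq_submatrix_of_support` (`VonNeumannEntropyOrthogonalSupports`); `vonNeumannEntropy_diagonal_ofReal`
(`VonNeumannEntropyConcavity`); `vonNeumannEntropy_submatrix_equiv`; Mathlib `Matrix.posSemidef_iff_dotProduct_mulVec`,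
`Real.negMulLog`, `Real.binEntropy`-free. `lean search 'vonNeumannEntropy.*convexComb.*le|mixing entropy'`: only the concavity direction (2026-08-27).

## References

* M. A. Nielsen, I. L. Chuang, *Quantum Computation and Quantum Information* (2010), Theorem 11.10 eq. (11.88) and its proof
  (p. 518–519), Theorem 11.14 (strong subadditivity / weak monotonicity). [cite: NielsenChuang2010, Theorem 11.10 eq. (11.88) p.518]
* E. H. Lieb, M. B. Ruskai, J. Math. Phys. 14 (1973) 1938, Theorems 1–2. [cite: LiebRuskai1973, Theorems 1–2]
-/

namespace Literature.InformationTheory.Entropy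

open Matrix Finset
open scoped BigOperators ComplexOrder

open Literature.Computability.QuantumComplexity (traceLeft traceRight IsDensity traceLeft_apply traceRight_apply)

section Mixing

variable {m X : Type} [Fintype m] [DecidableEq m] [Fintype X] [DecidableEq X]

/-! ### The classical-copy state `τ = Σ_x p_x ρ_x ⊗ |x⟩⟨x| ⊗ |x⟩⟨x|` and its four marginals -/

omit [Fintype m] [DecidableEq m] in
/-- The first marginal of `τ` is the mixture `Σ_x p_x ρ_x`. [cite: NielsenChuang2010, Theorem 11.10 eq. (11.88) p.518] -/
private theorem traceRight_traceLast_cqCopy (p : X → ℝ) (ρ : X → Matrix m m ℂ) (τ : Matrix (m × X × X) (m × X × X) ℂ)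
    (hτ : ∀ i j, τ i j = if i.2.1 = i.2.2 ∧ j.2.1 = j.2.2 ∧ i.2.1 = j.2.1 then ((p i.2.1 : ℝ) : ℂ) * ρ i.2.1 i.1 j.1 else 0) :
    traceRight (traceLast τ) = ∑ x, ((p x : ℝ) : ℂ) • ρ x := by
  ext b b'
  rw [traceRight_apply, Matrix.sum_apply]
  simp only [traceLast_apply, hτ, Matrix.smul_apply, smul_eq_mul, and_true]
  refine Finset.sum_congr rfl fun x _ => ?_
  rw [Finset.sum_eq_single x]
  · simp
  · intro y _ hyx; rw [if_neg]; tauto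
  · intro h; exact absurd (Finset.mem_univ x) h

omit [DecidableEq m] in
/-- The third marginal of `τ` is `diag(p)` (the densities have unit trace). [cite: NielsenChuang2010, Theorem 11.10 eq. (11.88) p.518] -/
private theorem traceLeft_traceLeft_cqCopy (p : X → ℝ) (ρ : X → Matrix m m ℂ) (hρ : ∀ x, (ρ x).trace = 1)
    (τ : Matrix (m × X × X) (m × X × X) ℂ)
    (hτ : ∀ i j, τ i j = if i.2.1 = i.2.2 ∧ j.2.1 = j.2.2 ∧ i.2.1 = j.2.1 then ((p i.2.1 : ℝ) : ℂ) * ρ i.2.1 i.1 j.1 else 0) :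
    traceLeft (traceLeft τ) = diagonal fun x => ((p x : ℝ) : ℂ) := by
  ext a a'
  have hentry : traceLeft (traceLeft τ) a a' = ∑ x : X, ∑ b : m, τ (b, x, a) (b, x, a') := by
    rw [traceLeft_apply]
    simp only [traceLeft_apply]
  rw [hentry]
  by_cases h : a = a'
  · subst h
    rw [diagonal_apply_eq]
    have hterm : ∀ x : X, (∑ b : m, τ (b, x, a) (b, x, a)) = if x = a then ((p a : ℝ) : ℂ) else 0 := by
      intro x
      by_cases hx : x = a
      · subst hx
        rw [if_pos rfl]
        have h1 : ∀ b : m, τ (b, x, x) (b, x, x) = ((p x : ℝ) : ℂ) * ρ x b b := fun b => by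
          rw [hτ]; simp
        simp only [h1]
        calc ∑ b, ((p x : ℝ) : ℂ) * ρ x b b = ((p x : ℝ) : ℂ) * ∑ b, ρ x b b := (Finset.mul_sum _ _ _).symm
          _ = ((p x : ℝ) : ℂ) * (ρ x).trace := rfl
          _ = ((p x : ℝ) : ℂ) := by rw [hρ x, mul_one]
      · rw [if_neg hx]
        refine Finset.sum_eq_zero fun b _ => ?_
        rw [hτ, if_neg]
        rintro ⟨h1, _, _⟩
        exact hx h1
    simp only [hterm, Finset.sum_ite_eq', Finset.mem_univ, if_true]
  · rw [diagonal_apply_ne _ h]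
    refine Finset.sum_eq_zero fun x _ => Finset.sum_eq_zero fun b _ => ?_
    rw [hτ, if_neg]
    rintro ⟨h1, h2, _⟩
    exact h (h1.symm.trans h2)

omit [DecidableEq m] [Fintype X] in
/-- The `(2,3)` marginal of `τ` is diagonal on `X × X`, supported on the diagonal with entries `p`.
[cite: NielsenChuang2010, Theorem 11.10 eq. (11.88) p.518] -/
private theorem traceLeft_cqCopy (p : X → ℝ) (ρ : X → Matrix m m ℂ) (hρ : ∀ x, (ρ x).trace = 1)
    (τ : Matrix (m × X × X) (m × X × X) ℂ)
    (hτ : ∀ i j, τ i j = if i.2.1 = i.2.2 ∧ j.2.1 = j.2.2 ∧ i.2.1 = j.2.1 then ((p i.2.1 : ℝ) : ℂ) * ρ i.2.1 i.1 j.1 else 0) :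
    traceLeft τ = diagonal fun q : X × X => (((if q.1 = q.2 then p q.1 else 0 : ℝ)) : ℂ) := by
  ext q q'
  rw [traceLeft_apply]
  simp only [hτ]
  by_cases hqq : q = q'
  · subst hqq
    rw [diagonal_apply_eq]
    by_cases hd : q.1 = q.2
    · simp only [hd, and_self, if_true]
      rw [← Finset.mul_sum]
      have : ∑ b, ρ q.2 b b = (ρ q.2).trace := rfl
      rw [this, hρ, mul_one]
    · simp only [hd, false_and, if_false, Finset.sum_const_zero, Complex.ofReal_zero]
  · rw [diagonal_apply_ne _ hqq]
    refine Finset.sum_eq_zero fun b _ => ?_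
    rw [if_neg]
    rintro ⟨h1, h2, h3⟩
    exact hqq (Prod.ext h3 (h1.symm.trans (h3.trans h2)))

omit [Fintype m] [DecidableEq m] in
/-- The `(1,2)` marginal of `τ` is the block sum `Σ_x p_x (ρ_x ⊗ |x⟩⟨x|)`. [cite: NielsenChuang2010, Theorem 11.10 eq. (11.88) p.518] -/
private theorem traceLast_cqCopy (p : X → ℝ) (ρ : X → Matrix m m ℂ) (τ : Matrix (m × X × X) (m × X × X) ℂ)
    (hτ : ∀ i j, τ i j = if i.2.1 = i.2.2 ∧ j.2.1 = j.2.2 ∧ i.2.1 = j.2.1 then ((p i.2.1 : ℝ) : ℂ) * ρ i.2.1 i.1 j.1 else 0) :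
    traceLast τ = ∑ x, ((p x : ℝ) : ℂ) •
      Matrix.of (fun i j : m × X => if i.2 = x ∧ j.2 = x then ρ x i.1 j.1 else 0) := by
  ext i j
  obtain ⟨b, a⟩ := i
  obtain ⟨b', a'⟩ := j
  rw [traceLast_apply, Matrix.sum_apply]
  simp only [hτ, Matrix.smul_apply, Matrix.of_apply, smul_eq_mul]
  -- left: `Σ_y [a = y ∧ a' = y ∧ a = a'] p_a ρ_a b b'`; right: `Σ_x p_x [a = x ∧ a' = x] ρ_x b b'`
  by_cases h : a = a'
  · subst h
    rw [Finset.sum_eq_single a, Finset.sum_eq_single a]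
    · simp
    · intro x _ hxa; rw [if_neg]; · simp
      rintro ⟨h1, _⟩; exact hxa h1.symm
    · intro hh; exact absurd (Finset.mem_univ a) hh
    · intro y _ hya; rw [if_neg]; rintro ⟨h1, _⟩; exact hya h1.symm
    · intro hh; exact absurd (Finset.mem_univ a) hh
  · rw [Finset.sum_eq_zero, Finset.sum_eq_zero]
    · intro x _; rw [if_neg, mul_zero]; rintro ⟨h1, h2⟩; exact h (h1.trans h2.symm)
    · intro y _; rw [if_neg]; rintro ⟨_, _, h3⟩; exact h h3

/-! ### Entropies of the marginals -/

/-- `S` of the `(2,3)` marginal is `H(p)`. [cite: NielsenChuang2010, Theorem 11.10 eq. (11.88) p.518] -/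
private theorem vonNeumannEntropy_diag_pair (p : X → ℝ) :
    vonNeumannEntropy (diagonal fun q : X × X => (((if q.1 = q.2 then p q.1 else 0 : ℝ)) : ℂ)) = ∑ x, Real.negMulLog (p x) := by
  rw [vonNeumannEntropy_diagonal_ofReal, Fintype.sum_prod_type]
  refine Finset.sum_congr rfl fun x _ => ?_
  rw [Finset.sum_eq_single x]
  · simp
  · intro y _ hyx; rw [if_neg (Ne.symm hyx), Real.negMulLog_zero]
  · intro h; exact absurd (Finset.mem_univ x) h

/-- The block `ρ_x ⊗ |x⟩⟨x|` has the entropy of `ρ_x`. [cite: NielsenChuang2010, Theorem 11.8 (4) p.513] -/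
private theorem vonNeumannEntropy_block (ρ : X → Matrix m m ℂ) (hρ : ∀ x, (ρ x).IsHermitian) (x : X) :
    vonNeumannEntropy (Matrix.of (fun i j : m × X => if i.2 = x ∧ j.2 = x then ρ x i.1 j.1 else 0)) = vonNeumannEntropy (ρ x) := by
  set R : Matrix (m × X) (m × X) ℂ := Matrix.of (fun i j : m × X => if i.2 = x ∧ j.2 = x then ρ x i.1 j.1 else 0) with hR
  have hRh : R.IsHermitian := by
    refine Matrix.IsHermitian.ext fun i j => ?_
    simp only [hR, Matrix.of_apply]
    by_cases h : j.2 = x ∧ i.2 = x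
    · rw [if_pos h, if_pos ⟨h.2, h.1⟩, (hρ x).apply]
    · rw [if_neg h, if_neg (fun h' => h ⟨h'.2, h'.1⟩), star_zero]
  have hsupp : ∀ i j, ¬ (fun k : m × X => k.2 = x) j → R i j = 0 := by
    intro i j hj
    simp only [hR, Matrix.of_apply]
    rw [if_neg]
    exact fun h => hj h.2
  rw [vonNeumannEntropy_eq_submatrix_of_support (fun k : m × X => k.2 = x) hRh hsupp]
  -- the compression is `ρ x` reindexed along `{k // k.2 = x} ≃ m`
  let e : m ≃ {k : m × X // k.2 = x} := ⟨fun b => ⟨(b, x), rfl⟩, fun k => k.1.1, fun b => rfl,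
    fun k => by obtain ⟨⟨b, y⟩, hy⟩ := k; cases hy; rfl⟩
  have hsub : (R.submatrix (Subtype.val : {k : m × X // k.2 = x} → m × X) Subtype.val).submatrix e e = ρ x := by
    ext b b'
    simp [hR, e]
  rw [← vonNeumannEntropy_submatrix_equiv (hRh.submatrix _) e, hsub]

/-- `S` of the `(1,2)` marginal is `Σ_x (p_x S(ρ_x) + η(p_x))`. [cite: NielsenChuang2010, §11.3.5 eq. (11.83) p.517] -/
private theorem vonNeumannEntropy_blockSum (p : X → ℝ) (ρ : X → Matrix m m ℂ) (hρ : ∀ x, IsDensity (ρ x)) :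
    vonNeumannEntropy (∑ x, ((p x : ℝ) : ℂ) •
      Matrix.of (fun i j : m × X => if i.2 = x ∧ j.2 = x then ρ x i.1 j.1 else 0)) =
      ∑ x, (p x * vonNeumannEntropy (ρ x) + Real.negMulLog (p x)) := by
  have hH : ∀ x, (Matrix.of (fun i j : m × X => if i.2 = x ∧ j.2 = x then ρ x i.1 j.1 else 0)).IsHermitian := by
    intro x
    refine Matrix.IsHermitian.ext fun i j => ?_
    simp only [Matrix.of_apply]
    by_cases h : j.2 = x ∧ i.2 = x
    · rw [if_pos h, if_pos ⟨h.2, h.1⟩, (hρ x).1.1.apply]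
    · rw [if_neg h, if_neg (fun h' => h ⟨h'.2, h'.1⟩), star_zero]
  have htr : ∀ x, (Matrix.of (fun i j : m × X => if i.2 = x ∧ j.2 = x then ρ x i.1 j.1 else 0)).trace = 1 := by
    intro x
    simp only [Matrix.trace, Matrix.diag, Matrix.of_apply, and_self]
    rw [Fintype.sum_prod_type]
    rw [Finset.sum_comm, Finset.sum_eq_single x]
    · simp only [if_true]
      exact (hρ x).2
    · intro y _ hyx; exact Finset.sum_eq_zero fun b _ => if_neg hyx
    · intro h; exact absurd (Finset.mem_univ x) h
  have hsupp : ∀ x (i j : m × X), ¬ ((fun k : m × X => k.2) i = x ∧ (fun k : m × X => k.2) j = x) →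
      (Matrix.of (fun i j : m × X => if i.2 = x ∧ j.2 = x then ρ x i.1 j.1 else 0)) i j = 0 := by
    intro x i j h
    simp only [Matrix.of_apply]
    exact if_neg h
  rw [vonNeumannEntropy_sum_smul_of_orthogonalSupports (fun k : m × X => k.2) hH htr hsupp p]
  refine Finset.sum_congr rfl fun x _ => ?_
  rw [vonNeumannEntropy_block ρ (fun y => (hρ y).1.1) x]

/-! ### `τ` is a density matrix -/

omit [DecidableEq m] in
/-- `τ` is a density matrix. [cite: NielsenChuang2010, Theorem 11.10 eq. (11.88) p.518] -/
private theorem isDensity_cqCopy (p : X → ℝ) (hp : ∀ x, 0 ≤ p x) (hp1 : ∑ x, p x = 1) (ρ : X → Matrix m m ℂ)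
    (hρ : ∀ x, IsDensity (ρ x)) (τ : Matrix (m × X × X) (m × X × X) ℂ)
    (hτ : ∀ i j, τ i j = if i.2.1 = i.2.2 ∧ j.2.1 = j.2.2 ∧ i.2.1 = j.2.1 then ((p i.2.1 : ℝ) : ℂ) * ρ i.2.1 i.1 j.1 else 0) :
    IsDensity τ := by
  refine ⟨?_, ?_⟩
  · rw [Matrix.posSemidef_iff_dotProduct_mulVec]
    refine ⟨?_, ?_⟩
    · refine Matrix.IsHermitian.ext fun i j => ?_
      rw [hτ, hτ]
      by_cases h : j.2.1 = j.2.2 ∧ i.2.1 = i.2.2 ∧ j.2.1 = i.2.1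
      · obtain ⟨h1, h2, h3⟩ := h
        rw [if_pos ⟨h1, h2, h3⟩, if_pos ⟨h2, h1, h3.symm⟩, star_mul', Complex.star_def, Complex.conj_ofReal, h3]
        congr 1
        exact (hρ i.2.1).1.1.apply i.1 j.1
      · rw [if_neg h, if_neg (fun h' => h ⟨h'.2.1, h'.1, h'.2.2.symm⟩), star_zero]
    · intro v
      -- `(τ v)(b,x,y) = [x = y] p_x (ρ_x v_x)(b)` with `v_x(b) = v(b,x,x)`
      have hmv : ∀ i : m × X × X, (τ *ᵥ v) i =
          if i.2.1 = i.2.2 then ((p i.2.1 : ℝ) : ℂ) * (ρ i.2.1 *ᵥ fun b => v (b, i.2.1, i.2.1)) i.1 else 0 := by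
        intro i
        obtain ⟨b, x, y⟩ := i
        simp only [mulVec, dotProduct]
        by_cases hxy : x = y
        · subst hxy
          rw [if_pos rfl, Finset.mul_sum, Fintype.sum_prod_type]
          refine Finset.sum_congr rfl fun b' _ => ?_
          rw [Fintype.sum_prod_type, Finset.sum_eq_single x]
          · rw [Finset.sum_eq_single x]
            · rw [hτ]; simp [mul_assoc]
            · intro y' _ hy'; rw [hτ, if_neg, zero_mul]; rintro ⟨_, h2, _⟩; exact hy' h2.symm
            · intro h; exact absurd (Finset.mem_univ x) h
          · intro x' _ hx'
            refine Finset.sum_eq_zero fun y' _ => ?_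
            rw [hτ, if_neg, zero_mul]; rintro ⟨_, _, h3⟩; exact hx' h3.symm
          · intro h; exact absurd (Finset.mem_univ x) h
        · rw [if_neg hxy]
          refine Finset.sum_eq_zero fun j _ => ?_
          rw [hτ, if_neg, zero_mul]; rintro ⟨h1, _, _⟩; exact hxy h1
      have hexp : star v ⬝ᵥ (τ *ᵥ v) =
          ∑ x, ((p x : ℝ) : ℂ) * (star (fun b => v (b, x, x)) ⬝ᵥ (ρ x *ᵥ fun b => v (b, x, x))) := by
        rw [dotProduct, Fintype.sum_prod_type]
        -- `Σ_b Σ_(x,y) star v(b,x,y) (τv)(b,x,y) = Σ_b Σ_x star v(b,x,x) p_x (ρ_x v_x)(b)`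
        have hinner : ∀ b : m, (∑ q : X × X, star (v (b, q)) * (τ *ᵥ v) (b, q)) =
            ∑ x : X, star (v (b, x, x)) * (((p x : ℝ) : ℂ) * (ρ x *ᵥ fun b' => v (b', x, x)) b) := by
          intro b
          rw [Fintype.sum_prod_type]
          refine Finset.sum_congr rfl fun x _ => ?_
          rw [Finset.sum_eq_single x]
          · rw [hmv]; simp
          · intro y _ hyx; rw [hmv, if_neg (Ne.symm hyx), mul_zero]
          · intro h; exact absurd (Finset.mem_univ x) h
        simp only [Pi.star_apply] at hinner ⊢
        rw [Finset.sum_congr rfl fun b _ => hinner b, Finset.sum_comm]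
        refine Finset.sum_congr rfl fun x _ => ?_
        rw [dotProduct, Finset.mul_sum]
        refine Finset.sum_congr rfl fun b _ => ?_
        simp only [Pi.star_apply]
        ring
      rw [hexp]
      refine Finset.sum_nonneg fun x _ => mul_nonneg (Complex.zero_le_real.2 (hp x)) ?_
      exact (Matrix.posSemidef_iff_dotProduct_mulVec.1 (hρ x).1).2 _
  · -- trace
    have hdiag : ∀ i : m × X × X, τ i i = if i.2.1 = i.2.2 then ((p i.2.1 : ℝ) : ℂ) * ρ i.2.1 i.1 i.1 else 0 := by
      intro i; rw [hτ]; simp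
    simp only [Matrix.trace, Matrix.diag, hdiag]
    rw [Fintype.sum_prod_type, Finset.sum_comm]
    simp only [Fintype.sum_prod_type]
    -- `Σ_x Σ_y Σ_b [x = y] p_x ρ_x b b = Σ_x p_x`
    have hx : ∀ x : X, (∑ y : X, ∑ b : m, if x = y then ((p x : ℝ) : ℂ) * ρ x b b else 0) = ((p x : ℝ) : ℂ) := by
      intro x
      simp only [Finset.sum_ite_irrel, Finset.sum_const_zero, Finset.sum_ite_eq, Finset.mem_univ, if_true]
      calc ∑ b, ((p x : ℝ) : ℂ) * ρ x b b = ((p x : ℝ) : ℂ) * ∑ b, ρ x b b := (Finset.mul_sum _ _ _).symm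
        _ = ((p x : ℝ) : ℂ) * (ρ x).trace := rfl
        _ = ((p x : ℝ) : ℂ) := by rw [(hρ x).2, mul_one]
    rw [Finset.sum_congr rfl fun x _ => hx x, ← Complex.ofReal_sum, hp1, Complex.ofReal_one]

/-! ### The bound -/

/-- **The mixing-entropy bound** `S(Σ_x p_x ρ_x) ≤ Σ_x p_x S(ρ_x) + Σ_x η(p_x)` for density matrices `ρ_x` and a probability
vector `p` (all index types in `Type`). [cite: NielsenChuang2010, Theorem 11.10 eq. (11.88) p.518] [cite: LiebRuskai1973, Theorems 1–2] -/
theorem vonNeumannEntropy_convexComb_le_add_negMulLog (p : X → ℝ) (hp : ∀ x, 0 ≤ p x) (hp1 : ∑ x, p x = 1)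
    (ρ : X → Matrix m m ℂ) (hρ : ∀ x, IsDensity (ρ x)) :
    vonNeumannEntropy (∑ x, ((p x : ℝ) : ℂ) • ρ x) ≤
      ∑ x, p x * vonNeumannEntropy (ρ x) + ∑ x, Real.negMulLog (p x) := by
  set τ : Matrix (m × X × X) (m × X × X) ℂ := Matrix.of fun i j =>
    if i.2.1 = i.2.2 ∧ j.2.1 = j.2.2 ∧ i.2.1 = j.2.1 then ((p i.2.1 : ℝ) : ℂ) * ρ i.2.1 i.1 j.1 else 0 with hτdef
  have hτ : ∀ i j, τ i j = if i.2.1 = i.2.2 ∧ j.2.1 = j.2.2 ∧ i.2.1 = j.2.1 then ((p i.2.1 : ℝ) : ℂ) * ρ i.2.1 i.1 j.1 else 0 :=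
    fun i j => rfl
  have hρtr : ∀ x, (ρ x).trace = 1 := fun x => (hρ x).2
  have hWM := weak_monotonicity_holds m X X τ (isDensity_cqCopy p hp hp1 ρ hρ τ hτ)
  rw [traceRight_traceLast_cqCopy p ρ τ hτ, traceLeft_traceLeft_cqCopy p ρ hρtr τ hτ, traceLast_cqCopy p ρ τ hτ,
    traceLeft_cqCopy p ρ hρtr τ hτ, vonNeumannEntropy_diagonal_ofReal, vonNeumannEntropy_blockSum p ρ hρ,
    vonNeumannEntropy_diag_pair] at hWM
  rw [Finset.sum_add_distrib] at hWM
  linarith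

/-- **Two-point form**: `S((1−t)ρ + tσ) ≤ (1−t)S(ρ) + tS(σ) + η(1−t) + η(t)` for densities `ρ, σ` and `t ∈ [0,1]`.
[cite: NielsenChuang2010, Theorem 11.10 eq. (11.88) p.518] -/
theorem vonNeumannEntropy_convexComb_two_le {t : ℝ} (ht0 : 0 ≤ t) (ht1 : t ≤ 1) {ρ σ : Matrix m m ℂ}
    (hρ : IsDensity ρ) (hσ : IsDensity σ) :
    vonNeumannEntropy ((((1 - t : ℝ)) : ℂ) • ρ + ((t : ℝ) : ℂ) • σ) ≤
      (1 - t) * vonNeumannEntropy ρ + t * vonNeumannEntropy σ + (Real.negMulLog (1 - t) + Real.negMulLog t) := by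
  have h := vonNeumannEntropy_convexComb_le_add_negMulLog (X := Bool) (fun b => if b then t else 1 - t)
    (fun b => by cases b <;> simp [ht0, sub_nonneg.2 ht1]) (by simp) (fun b => if b then σ else ρ)
    (fun b => by cases b <;> simpa)
  simp only [Fintype.sum_bool, if_true, if_false, Bool.false_eq_true] at h
  rw [add_comm (((t : ℝ) : ℂ) • σ)] at h
  linarith

/-- **Two-point form with `log 2`**: `S((1−t)ρ + tσ) ≤ (1−t)S(ρ) + tS(σ) + log 2`. [cite: NielsenChuang2010, Theorem 11.10 eq. (11.88) p.518] -/
theorem vonNeumannEntropy_convexComb_two_le_add_log_two {t : ℝ} (ht0 : 0 ≤ t) (ht1 : t ≤ 1) {ρ σ : Matrix m m ℂ}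
    (hρ : IsDensity ρ) (hσ : IsDensity σ) :
    vonNeumannEntropy ((((1 - t : ℝ)) : ℂ) • ρ + ((t : ℝ) : ℂ) • σ) ≤
      (1 - t) * vonNeumannEntropy ρ + t * vonNeumannEntropy σ + Real.log 2 := by
  have h := vonNeumannEntropy_convexComb_two_le ht0 ht1 hρ hσ
  -- `η(1−t) + η(t) ≤ log 2` (binary entropy)
  have hb : Real.negMulLog (1 - t) + Real.negMulLog t ≤ Real.log 2 := by
    have := Real.binEntropy_le_log_two (p := t)
    rw [Real.binEntropy_eq_negMulLog_add_negMulLog_one_sub] at this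
    linarith
  linarith

end Mixing

end Literature.InformationTheory.Entropy
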